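import Literature.NumberTheory.Automorphic.SolvableBaseChangeModularityProofs
import Literature.NumberTheory.Automorphic.TotallyRealModularity
import Literature.NumberTheory.EllipticCurves.IsogenyHasCMProofs
import HarnessLib
import Literature.NumberTheory.Automorphic.RealQuadraticJInvariantModularity

/-!
# Route `SqrtFiveQuarticCovers` (cell lg-quartmod, rung F-L1) — the bridge `JInSqrtFiveModular`:
# elliptic curves over a totally real quartic `K ∋ √5` whose `j`-invariant lies in `ℚ(√5)` are
# modular, modulo named facts (FLS 2015 Thm. 1 + soluble base change; twist invariance PROVED)

On each of the route's carrier curves the quadratic points over `k = ℚ(√5)` lying over `k`-points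
of the coarse curve carry elliptic curves `E / K` (`K ⊋ k` totally real quartic) with `j(E) ∈ k`;
the lead's typing v3 (`HOME/lg-quartmod-lead/RefinedLocusTyping.lean`) isolates this as the bridge
`Census.JInSqrtFiveModular`, consumed by every sheet certificate (`RL2_35_of_JExc2_35`,
`RLpair_s3_H8_of`, …).  The printed reason (FLS 2015 §7 Lemma `lem:Qsqrt5` and §5 p. 33; Box 2022
§1.2 p. 5): `E₀ / k` with `j(E₀) = j(E)` is modular (FLS Thm. 1) ⟹ `E₀ ⊗_k K` is modular
(cyclic base change, `K/k` quadratic: Langlands 1980; Thorne 2016 Lemma 7.1) ⟹ `E`, a quadratic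
twist of `E₀ ⊗_k K` when `j ∉ {0,1728}`, is modular; `j ∈ {0,1728}` is CM.

Contents (no `sorry`; the only definition is ONE named Literature fact stated inline for the gate
to relocate, per the mid-proof-fact protocol):

* `isModularEllipticCurve_baseChange_of_isSolvable_of_isAutomorphicOfWeightZero` — NAMED FACT
  (D-0014): soluble totally real base change of modularity for elliptic curves over a TOTALLY REAL
  base `F` (Thorne 2016 Lemma 7.1; the general-`F` form of the tree's
  `isModularEllipticCurve_baseChange_rat_of_isSolvable`, which is `F = ℚ` with BCDT folded in).
  Debt +1, said plainly; Galois-side general form already in the tree: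
  `ACC2023.solubleBaseChange_isAutomorphic`.
* private helpers `jModel_*` — the integral model `y² = x³ + 3p(1728q − p)q²x + 2p(1728q − p)²q³`
  of `j`-invariant `p/q` over any commutative ring (the tree's `ratJModel` is the case `ℤ`), as an
  anonymous-constructor curve (no new definition).
* `isModularEllipticCurve_of_jInvariant_eq_algebraMap_of_finrank_eq_two` — for `F` totally real of
  degree `2`, `K/F` finite Galois soluble, `K` totally real, `E / 𝓞 K` (`Δ ≠ 0`) with
  `c₄³/Δ = j₀ ∈ F`: `IsModularEllipticCurve K E`, modulo `FLS2015_theorem1` and the fact above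
  (twist step = the PROVED `isModularEllipticCurve_of_jInvariant_eq_holds`; CM step = the PROVED
  `WeierstrassCurve.HasCM.of_j_eq_zero_or_1728`).
* `minpoly_eq_X_sq_sub_five`, `jInSqrtFive_modular_of_facts` — the bridge in EXACTLY the shape of
  the lead's `Census.JInSqrtFiveModular` (so it is consumed by `exact`): `F = ℚ(r) ⊆ K`, `r² = 5`,
  is real quadratic, `[K : F] = 2` by the tower law, `K/F` Galois with cyclic group.

HONEST STATUS: conditional on two cited theorems (FLS 2015 Thm. 1; Thorne 2016 Lemma 7.1 /
Langlands base change) taken as named facts; nothing here proves modularity of a new class of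
elliptic curves — it certifies that the «harmless» points (`j ∈ ℚ(√5)`) of the F-L1 census are
harmless for the printed reason.  This file does NOT import the route file (theses-cone hygiene).

References: [FreitasLeHungSiksek2015] Invent. Math. 201 (2015), Thm. 1; §5 (p. 33); §7;
[Thorne2016] Math. Ann. 364 (2016), Lemma 7.1; [Langlands1980AMS96] Ch. 2; [Box2022] §1.2
(p. 5); [AllenCalegariCaraianiGeeEtAl2023] Prop. 6.5.13; [SilvermanAEC2009] III.1, X.5.
-/

open scoped NumberField Polynomial IntermediateField
open NumberField Polynomial Literature.NumberTheory.Automorphic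

noncomputable section

set_option linter.dupNamespace false -- project-wide option; `Summit.Langlands.Langlands` is the mandated namespace

namespace Summit.Langlands.Langlands.Theorems.SqrtFiveQuarticCovers

/-! ### The named fact: soluble totally real base change of modularity (general totally real base) -/

section jModel

variable {R : Type*} [CommRing R] (p q : R)

/-- `c₄` of `y² = x³ + 3p(1728q − p)q²x + 2p(1728q − p)²q³` is `-144·p(1728q − p)q²`. [folklore] -/
private theorem jModel_c₄ :
    (⟨0, 0, 0, 3 * p * (1728 * q - p) * q ^ 2, 2 * p * (1728 * q - p) ^ 2 * q ^ 3⟩ :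
      WeierstrassCurve R).c₄ = -144 * p * (1728 * q - p) * q ^ 2 := by
  simp only [WeierstrassCurve.c₄, WeierstrassCurve.b₂, WeierstrassCurve.b₄]
  ring

/-- The discriminant of `y² = x³ + 3p(1728q − p)q²x + 2p(1728q − p)²q³` is
`-2985984·p²(1728q − p)³q⁷`. [folklore] -/
private theorem jModel_Δ :
    (⟨0, 0, 0, 3 * p * (1728 * q - p) * q ^ 2, 2 * p * (1728 * q - p) ^ 2 * q ^ 3⟩ :
      WeierstrassCurve R).Δ = -2985984 * p ^ 2 * (1728 * q - p) ^ 3 * q ^ 7 := by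
  simp only [WeierstrassCurve.Δ, WeierstrassCurve.b₂, WeierstrassCurve.b₄,
    WeierstrassCurve.b₆, WeierstrassCurve.b₈]
  ring

/-- `c₄³ · q = p · Δ` for the model of `j`-invariant `p/q` (so `j = c₄³/Δ = p/q`). [folklore] -/
private theorem jModel_c₄_pow_three_mul :
    (⟨0, 0, 0, 3 * p * (1728 * q - p) * q ^ 2, 2 * p * (1728 * q - p) ^ 2 * q ^ 3⟩ :
      WeierstrassCurve R).c₄ ^ 3 * q =
      p * (⟨0, 0, 0, 3 * p * (1728 * q - p) * q ^ 2, 2 * p * (1728 * q - p) ^ 2 * q ^ 3⟩ :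
        WeierstrassCurve R).Δ := by
  rw [jModel_c₄, jModel_Δ]
  ring

/-- Non-singularity: `Δ ≠ 0` when `p ≠ 0`, `q ≠ 0`, `p ≠ 1728q` in a domain of characteristic
zero. [folklore] -/
private theorem jModel_Δ_ne_zero [IsDomain R] [CharZero R] {p q : R} (hp : p ≠ 0) (hq : q ≠ 0)
    (hpq : p ≠ 1728 * q) :
    (⟨0, 0, 0, 3 * p * (1728 * q - p) * q ^ 2, 2 * p * (1728 * q - p) ^ 2 * q ^ 3⟩ :
      WeierstrassCurve R).Δ ≠ 0 := by
  rw [jModel_Δ]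
  have h : 1728 * q - p ≠ 0 := sub_ne_zero.2 (Ne.symm hpq)
  simp [h, hp, hq]

end jModel

/-! ### The theorem: `j` in a real quadratic subfield -/

/-- **Elliptic curves over a totally real soluble extension `K` of a real quadratic field `F` with
`j`-invariant in `F` are modular** (modulo the named facts `FLS2015_theorem1` and
`isModularEllipticCurve_baseChange_of_isSolvable_of_isAutomorphicOfWeightZero`; the twist step is
the PROVED `isModularEllipticCurve_of_jInvariant_eq_holds`, the CM step the PROVED
`WeierstrassCurve.HasCM.of_j_eq_zero_or_1728`).  Let `F` be totally real with `[F : ℚ] = 2`,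
`K / F` finite Galois with solvable group, `K` totally real, `E` a Weierstrass model over `𝓞 K`
with `Δ(E) ≠ 0` and `c₄(E)³/Δ(E) = j₀ ∈ F`.  Then `E` is modular (`IsModularEllipticCurve K E`):
if `j₀ ∈ {0, 1728}` the curve has geometric CM; otherwise write `j₀ = p/q` with `p, q ∈ 𝓞 F`,
take the integral model `E₀ : y² = x³ + 3p(1728q − p)q²x + 2p(1728q − p)²q³` (`j(E₀) = j₀`),
modular over `F` by FLS Thm. 1, over `K` by base change, and pass to `E` (same `j ∉ {0,1728}`) by
twist invariance.  [cite: FreitasLeHungSiksek2015, Thm. 1, §5 (p. 33), §7]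
[cite: Thorne2016, Lemma 7.1] [cite: Box2022, §1.2 (p. 5)] -/
theorem isModularEllipticCurve_of_jInvariant_eq_algebraMap_of_finrank_eq_two
    (hFLS : FLS2015_theorem1)
    (hBC : Literature.NumberTheory.Automorphic.isModularEllipticCurve_baseChange_of_isSolvable_of_isAutomorphicOfWeightZero)
    (F : Type) [Field F] [NumberField F] [IsTotallyReal F] (hF : Module.finrank ℚ F = 2)
    (K : Type) [Field K] [NumberField K] [IsTotallyReal K] [Algebra F K] [IsGalois F K]
    [IsSolvable (K ≃ₐ[F] K)]
    (E : WeierstrassCurve (𝓞 K)) (hΔ : E.Δ ≠ 0) (j₀ : F)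
    (hj : (algebraMap (𝓞 K) K E.c₄) ^ 3 / algebraMap (𝓞 K) K E.Δ = algebraMap F K j₀) :
    IsModularEllipticCurve K E := by
  classical
  by_cases h01 : j₀ = 0 ∨ j₀ = 1728
  · -- CM: `j(E ⊗ K) ∈ {0, 1728}`
    haveI hW : (E.baseChange K).IsElliptic := isElliptic_baseChange_of_Δ_ne_zero hΔ
    have hjE : (E.baseChange K).j = algebraMap F K j₀ :=
      (j_baseChange_eq_c₄_pow_div hΔ).trans hj
    refine Or.inl (WeierstrassCurve.HasCM.of_j_eq_zero_or_1728 ?_)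
    rcases h01 with h | h
    · exact Or.inl (by rw [hjE, h, map_zero])
    · exact Or.inr (by rw [hjE, h, map_ofNat])
  push Not at h01
  obtain ⟨hj0, hj1728⟩ := h01
  -- `j₀ = p / q` with `p, q ∈ 𝓞 F`
  obtain ⟨p, q, hqnz, hpq⟩ := IsFractionRing.div_surjective (A := 𝓞 F) j₀
  have hq : q ≠ 0 := nonZeroDivisors.ne_zero hqnz
  have hqF : algebraMap (𝓞 F) F q ≠ 0 :=
    (map_ne_zero_iff _ (FaithfulSMul.algebraMap_injective (𝓞 F) F)).2 hq
  have hp : p ≠ 0 := by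
    rintro rfl
    apply hj0
    rw [← hpq, map_zero, zero_div]
  have hp1728 : p ≠ 1728 * q := by
    intro h
    apply hj1728
    rw [← hpq, h, map_mul, map_ofNat, mul_div_assoc, div_self hqF, mul_one]
  -- the integral model `E₀` over `𝓞 F`
  set E₀ : WeierstrassCurve (𝓞 F) :=
    ⟨0, 0, 0, 3 * p * (1728 * q - p) * q ^ 2, 2 * p * (1728 * q - p) ^ 2 * q ^ 3⟩ with hE₀
  have hΔ₀ : E₀.Δ ≠ 0 := jModel_Δ_ne_zero hp hq hp1728
  -- FLS Thm. 1 over `F`, base change to `K`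
  have hmodK : IsModularEllipticCurve K (E₀.baseChange (𝓞 K)) :=
    hBC F K E₀ hΔ₀ (hFLS F hF E₀ hΔ₀)
  -- `j(E₀ ⊗ 𝓞 K) = j₀` in `K`
  have hc : algebraMap (𝓞 K) K (E₀.baseChange (𝓞 K)).c₄ = algebraMap F K (algebraMap (𝓞 F) F E₀.c₄) := by
    rw [WeierstrassCurve.baseChange, WeierstrassCurve.map_c₄, ← IsScalarTower.algebraMap_apply,
      ← IsScalarTower.algebraMap_apply]
  have hd : algebraMap (𝓞 K) K (E₀.baseChange (𝓞 K)).Δ = algebraMap F K (algebraMap (𝓞 F) F E₀.Δ) := by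
    rw [WeierstrassCurve.baseChange, WeierstrassCurve.map_Δ, ← IsScalarTower.algebraMap_apply,
      ← IsScalarTower.algebraMap_apply]
  have hjF : (algebraMap (𝓞 F) F E₀.c₄) ^ 3 / algebraMap (𝓞 F) F E₀.Δ = j₀ := by
    have hΔF : algebraMap (𝓞 F) F E₀.Δ ≠ 0 :=
      (map_ne_zero_iff _ (FaithfulSMul.algebraMap_injective (𝓞 F) F)).2 hΔ₀
    rw [div_eq_iff hΔF, ← hpq, div_mul_eq_mul_div, eq_div_iff hqF, ← map_pow, ← map_mul, ← map_mul,
      jModel_c₄_pow_three_mul p q, mul_comm]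
  have hj' : (algebraMap (𝓞 K) K (E₀.baseChange (𝓞 K)).c₄) ^ 3 /
      algebraMap (𝓞 K) K (E₀.baseChange (𝓞 K)).Δ = algebraMap F K j₀ := by
    rw [hc, hd, ← map_pow, ← map_div₀, hjF]
  have hΔ₀K : (E₀.baseChange (𝓞 K)).Δ ≠ 0 := by
    intro h
    have h' : algebraMap F K (algebraMap (𝓞 F) F E₀.Δ) = 0 := by rw [← hd, h, map_zero]
    exact hΔ₀ ((FaithfulSMul.algebraMap_injective (𝓞 F) F)
      (((algebraMap F K).injective) (h'.trans (map_zero _).symm) |>.trans (map_zero _).symm))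
  have hj0K : algebraMap F K j₀ ≠ 0 := (map_ne_zero_iff _ (algebraMap F K).injective).2 hj0
  have hj1728K : algebraMap F K j₀ ≠ 1728 := by
    intro h
    apply hj1728
    apply (algebraMap F K).injective
    rw [h, map_ofNat]
  -- twist invariance (`j ∉ {0, 1728}`)
  refine isModularEllipticCurve_of_jInvariant_eq_holds K (E₀.baseChange (𝓞 K)) E hΔ₀K hΔ
    (hj'.trans hj.symm) ?_ ?_ hmodK
  · rw [hj']; exact hj0K
  · rw [hj']; exact hj1728K


/-! ### The bridge in the lead's exact shape -/

/-- `X² − 5` is the minimal polynomial of a square root of `5` in a field of characteristic zero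
containing `ℚ` (`5` is not a rational square). [folklore] -/
theorem minpoly_eq_X_sq_sub_five {K : Type} [Field K] [CharZero K] [Algebra ℚ K] {r : K}
    (hr : r ^ 2 = 5) : minpoly ℚ r = X ^ 2 - C (5 : ℚ) := by
  refine (minpoly.eq_of_irreducible_of_monic ?_ ?_ (monic_X_pow_sub_C (5 : ℚ) two_ne_zero)).symm
  · refine (X_pow_sub_C_irreducible_iff_of_prime Nat.prime_two).2 fun b hb => ?_
    have h5 : IsSquare (5 : ℚ) := ⟨b, by rw [← sq]; exact hb.symm⟩
    rw [Rat.isSquare_iff] at h5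
    have h5n : IsSquare (5 : ℕ) := by
      have h5z : IsSquare ((5 : ℕ) : ℤ) := by simpa using h5.1
      exact Int.isSquare_natCast_iff.1 h5z
    obtain ⟨n, hn⟩ := h5n
    have hn3 : n ≤ 3 := by nlinarith
    interval_cases n <;> omega
  · simp [hr]

/-- **`JInSqrtFiveModular` (lead typing v3, cell lg-quartmod / F-L1), modulo named facts.**  For
`K` totally real quartic containing `√5` and `E / 𝓞 K` (`Δ ≠ 0`) whose `j`-invariant lies in
`ℚ(√5)` — written division-free as `c₄(E_K)³ = (a + b·r)·Δ(E_K)` with `r² = 5`, `a b : ℚ` — the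
curve is modular in the route's written-out cone (geometric CM, or a weight-zero cuspidal `π` of
`GL₂(𝔸_K)` whose `T_w`-eigenvalue is `a_w(E)` at cofinitely many finite places `w`).  Proof:
`F = ℚ(r) ⊆ K` is a real quadratic field (`minpoly_ℚ r = X² − 5`), `[K : F] = 2` by the tower
law, so `K / F` is Galois with cyclic (hence solvable) group, and
`isModularEllipticCurve_of_jInvariant_eq_algebraMap_of_finrank_eq_two` applies with `j₀ = a + b r`.
CONDITIONAL on the named facts `FLS2015_theorem1` (FLS 2015 Thm. 1) and
`isModularEllipticCurve_baseChange_of_isSolvable_of_isAutomorphicOfWeightZero` (Thorne 2016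
Lemma 7.1); twist invariance and the CM cases are proved tree lemmas.  The statement is VERBATIM
the lead's `Census.JInSqrtFiveModular` (so `RLpair_s3_H8_of` consumes it by `exact`).
[cite: FreitasLeHungSiksek2015, Thm. 1 and §7] [cite: Thorne2016, Lemma 7.1]
[cite: Box2022, §1.2 (p. 5)] -/
theorem jInSqrtFive_modular_of_facts (hFLS : FLS2015_theorem1)
    (hBC : Literature.NumberTheory.Automorphic.isModularEllipticCurve_baseChange_of_isSolvable_of_isAutomorphicOfWeightZero) :
    ∀ (K : Type) [Field K] [NumberField K], NumberField.IsTotallyReal K → Module.finrank ℚ K = 4 →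
      (∃ r : K, r ^ 2 = 5) →
      ∀ E : WeierstrassCurve (NumberField.RingOfIntegers K), E.Δ ≠ 0 →
        (∃ r : K, r ^ 2 = 5 ∧ ∃ a b : ℚ,
          (E.baseChange K).c₄ ^ 3 = ((a : K) + (b : K) * r) * (E.baseChange K).Δ) →
        ((E.baseChange K).HasCM ∨
          ∃ (hF : Literature.NumberTheory.Automorphic.isCompact_glFiniteIntegralLevel 2 K)
            (π : Literature.NumberTheory.Automorphic.CuspidalAutomorphicRepData 2 K hF),
            π.1.HasWeightZero ∧
              ∀ᶠ w : IsDedekindDomain.HeightOneSpectrum (NumberField.RingOfIntegers K) in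
                Filter.cofinite, ∃ α : Multiset ℂ, π.1.HasSatakeParamAt w α ∧
                  ((Real.sqrt w.residueCard : ℝ) : ℂ) * α.sum =
                    (Literature.NumberTheory.Automorphic.frobTraceAt E w : ℂ)) := by
  intro K _ _ hK hd _ E hΔ hJ
  obtain ⟨r, hr, a, b, hab⟩ := hJ
  haveI : IsTotallyReal K := hK
  -- the real quadratic subfield `F = ℚ(r)`
  have hr_int : IsIntegral ℚ r := Algebra.IsIntegral.isIntegral r
  have hF2 : Module.finrank ℚ ℚ⟮r⟯ = 2 := by
    rw [IntermediateField.adjoin.finrank hr_int, minpoly_eq_X_sq_sub_five hr, natDegree_X_pow_sub_C]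
  haveI : IsTotallyReal ℚ⟮r⟯ := IsTotallyReal.of_algebra ℚ⟮r⟯ K
  have hFK : Module.finrank ℚ⟮r⟯ K = 2 := by
    have h := Module.finrank_mul_finrank ℚ ℚ⟮r⟯ K
    rw [hF2, hd] at h
    omega
  haveI : Algebra.IsQuadraticExtension ℚ⟮r⟯ K := ⟨hFK⟩
  haveI : IsGalois ℚ⟮r⟯ K := inferInstance
  haveI : IsSolvable (K ≃ₐ[ℚ⟮r⟯] K) :=
    isSolvable_of_comm fun x y => (IsCyclic.commGroup (α := K ≃ₐ[ℚ⟮r⟯] K)).mul_comm x y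
  -- `j₀ = a + b r ∈ F`
  have hmem : (a : K) + (b : K) * r ∈ ℚ⟮r⟯ := by
    refine add_mem ?_ (mul_mem ?_ (IntermediateField.mem_adjoin_simple_self ℚ r))
    · rw [← eq_ratCast (algebraMap ℚ K) a]; exact ℚ⟮r⟯.algebraMap_mem a
    · rw [← eq_ratCast (algebraMap ℚ K) b]; exact ℚ⟮r⟯.algebraMap_mem b
  set j₀ : ℚ⟮r⟯ := ⟨(a : K) + (b : K) * r, hmem⟩ with hj₀
  have hΔK : algebraMap (𝓞 K) K E.Δ ≠ 0 :=
    (map_ne_zero_iff _ (FaithfulSMul.algebraMap_injective (𝓞 K) K)).2 hΔ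
  have hc : (E.baseChange K).c₄ = algebraMap (𝓞 K) K E.c₄ := by
    rw [WeierstrassCurve.baseChange, WeierstrassCurve.map_c₄]
  have hdd : (E.baseChange K).Δ = algebraMap (𝓞 K) K E.Δ := by
    rw [WeierstrassCurve.baseChange, WeierstrassCurve.map_Δ]
  have hj : (algebraMap (𝓞 K) K E.c₄) ^ 3 / algebraMap (𝓞 K) K E.Δ = algebraMap ℚ⟮r⟯ K j₀ := by
    rw [div_eq_iff hΔK, ← hc, ← hdd, hab]
    rfl
  exact isModularEllipticCurve_of_jInvariant_eq_algebraMap_of_finrank_eq_two hFLS hBC ℚ⟮r⟯ hF2 K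
    E hΔ j₀ hj

end Summit.Langlands.Langlands.Theorems.SqrtFiveQuarticCovers

end
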